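import Mathlib.Analysis.Asymptotics.SpecificAsymptotics
import Literature.Probability.LatticeModels.ScalingLimit3D
import HarnessLib

/-!
# The Ising scaling relation `2Δ = d - 2 + η`: discharge of `isingScalingRelationHolds`

Sibling proof file of `Literature.Probability.LatticeModels.ScalingLimit3D` (which, containing
definitions and the registered open statements crit-ising.S01/S03, is review-gated; proofs live
here). It discharges the named fact

* `Literature.Probability.LatticeModels.isingScalingRelationHolds` (**crit-ising.S22**) — for
  every `d ≥ 2`, whenever the critical Ising correlators `⟨∏ σ_{xᵢ}⟩⁺_{β_c}` on `ℤ^d`,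
  renormalised by some `ρ > 0` on `(0,1]`, have a pointwise scaling limit `S` that is scale
  covariant with dimension `Δ` and has a non-degenerate two-point function, and the anomalous
  dimension `η` exists (`log ⟨σ₀σ_x⟩_{β_c} / log ‖x‖ → -(d-2+η)`), then `2Δ = d - 2 + η`
  (`IsingScalingRelation d Δ η`),

as `isingScalingRelationHolds_holds`, through the fixed-dimension form
`IsingScalingRelationHolds.of_neZero : IsingScalingRelationHolds d` (valid for every `d ≥ 1`).

## Source and proof architecture

Di Francesco–Mathieu–Sénéchal, *Conformal Field Theory* (Springer 1997), §4.3.1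
(pp. 104–106): covariance of the two-point function of quasi-primary fields under dilations
`x → λx`, eq. (4.49), `⟨φ₁(x₁)φ₂(x₂)⟩ = λ^{Δ₁+Δ₂} ⟨φ₁(λx₁)φ₂(λx₂)⟩`, forces the pure power
`C₁₂ / |x₁ - x₂|^{2Δ}`, eqs. (4.51)/(4.55), and "comparison with Table 3.1" (§3.2.1, where `η` is
*defined* by `Γ(n) ∝ |n|^{2-d-η}`) "shows that the exponent `η` is `η = 2Δ + 2 - d`", eq. (4.56).
For a *lattice* two-point function `G = ⟨σ₀σ_x⟩⁺_{β_c}` known only through (a) the scaling limit of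
`ρ(δ)² G([x/δ],[y/δ])` and (b) its logarithmic decay exponent `d - 2 + η`, the comparison is the
following elementary argument, which uses dilation covariance only at the two configurations
`(0, 𝟙)` and `(0, 2·𝟙)`, `𝟙 = (1,…,1) ∈ ℝ^d` (no translation or rotation invariance of `S`):

1. along the dyadic meshes `δ_k = 2^{-k} ∈ (0,1]` the lattice approximations are exact,
   `[t𝟙/δ_k] = t2^k 𝟙 ∈ ℤ^d` (`latticeApprox_dyadic_diag`), so the scaling limit at `(0, t𝟙)`
   reads `ρ(δ_k)² G(t2^k 𝟙) → S₂(0, t𝟙)` for `t = 1, 2` (`tendsto_rescaled_dyadic_diag`);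
2. dilation covariance gives `S₂(0, 2·𝟙) = 2^{-2Δ} S₂(0, 𝟙)` (`two_point_diag_two`) and
   non-degeneracy `S₂(0, 𝟙) > 0`, so in the ratio the unknown `ρ(δ_k)² > 0` cancels:
   `G(2^{k+1}𝟙) / G(2^k 𝟙) → 2^{-2Δ}` (`tendsto_ratio_dyadic`);
3. hence `log G(2^k 𝟙) / k → -2Δ log 2`, the Cesàro mean of the logarithmic increments
   (`tendsto_div_natCast_of_tendsto_sub`, `tendsto_log_dyadic_div`);
4. the decay exponent along the same sites, `‖2^k 𝟙‖_∞ = 2^k`, gives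
   `log G(2^k 𝟙) / (k log 2) → -(d - 2 + η)`; uniqueness of limits yields `2Δ = d - 2 + η`.

(The `d = 3` instance of steps 1–3, with `e₁` in place of `𝟙` and the roles of `ρ` and `G`
exchanged, is the architecture of `CriticalScalingDimension.lean`, which is not imported here; the
lemmas below are dimension-free and live in the sub-namespace `IsingScalingRelationHolds`, so no
name is shared.)

Mathlib anchors: `TendstoLocallyUniformlyOn.tendsto_at`, `tendsto_inv_atTop_nhdsGT_zero`,
`tendsto_pow_atTop_atTop_of_one_lt`, `Filter.Tendsto.cesaro`, `Finset.sum_range_sub`,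
`Filter.Tendsto.log`, `Real.log_rpow`, `Real.log_pow`, `pi_norm_const`, `Int.norm_natCast`,
`Function.Injective.tendsto_cofinite`, `Nat.cofinite_eq_atTop`, `Nat.pow_right_injective`,
`tendsto_nhds_unique`. No statement of `ScalingLimit3D` is changed; this file adds theorems only.
-/

noncomputable section

open Filter
open _root_.Topology

namespace Literature.Probability.LatticeModels

namespace IsingScalingRelationHolds

variable {d : ℕ}

/-! ### A Cesàro lemma -/

/-- Cesàro mean of increments: if `c (k+1) - c k → ℓ` then `c k / k → ℓ` (telescoping sum
`∑_{i<k} (c (i+1) - c i) = c k - c 0` and `Filter.Tendsto.cesaro`). Elementary. [folklore] -/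
theorem tendsto_div_natCast_of_tendsto_sub {c : ℕ → ℝ} {ℓ : ℝ}
    (h : Tendsto (fun k => c (k + 1) - c k) atTop (𝓝 ℓ)) :
    Tendsto (fun k : ℕ => c k / k) atTop (𝓝 ℓ) := by
  have h1 : Tendsto (fun k : ℕ => (k : ℝ)⁻¹ * (c k - c 0)) atTop (𝓝 ℓ) := by
    refine h.cesaro.congr fun k => ?_
    rw [Finset.sum_range_sub]
  have h2 : Tendsto (fun k : ℕ => c 0 / (k : ℝ)) atTop (𝓝 0) :=
    tendsto_const_div_atTop_nhds_zero_nat (c 0)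
  have h3 := h1.add h2
  rw [add_zero] at h3
  refine h3.congr fun k => ?_
  ring

/-! ### Dyadic meshes and exact diagonal lattice points -/

/-- The dyadic mesh `δ_k = 2^{-k}` lies in `(0, 1]`. [folklore] -/
theorem dyadic_mem_Ioc (k : ℕ) : ((2 : ℝ) ^ k)⁻¹ ∈ Set.Ioc (0 : ℝ) 1 :=
  ⟨by positivity, inv_le_one_of_one_le₀ (one_le_pow₀ (by norm_num))⟩

/-- `δ_k = 2^{-k} → 0⁺`. [folklore] -/
theorem tendsto_dyadic : Tendsto (fun k : ℕ => ((2 : ℝ) ^ k)⁻¹) atTop (𝓝[>] (0 : ℝ)) :=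
  tendsto_inv_atTop_nhdsGT_zero.comp (tendsto_pow_atTop_atTop_of_one_lt one_lt_two)

/-- **Exact lattice points along the diagonal**: `[t𝟙 / 2^{-k}] = t2^k 𝟙 = (t2^k, …, t2^k)` for
`t ∈ ℕ` (`latticeApprox δ x = (⌊x_i/δ⌋)_i`). [folklore] -/
theorem latticeApprox_dyadic_diag (k t : ℕ) :
    latticeApprox (((2 : ℝ) ^ k)⁻¹) (WithLp.toLp 2 fun _ : Fin d => (t : ℝ)) =
      fun _ => ((t * 2 ^ k : ℕ) : ℤ) := by
  funext i
  rw [latticeApprox_apply, PiLp.toLp_apply, div_inv_eq_mul]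
  have h : (t : ℝ) * 2 ^ k = (((t * 2 ^ k : ℕ) : ℤ) : ℝ) := by push_cast; ring
  rw [h, Int.floor_intCast]

/-- `[0/δ] = 0` (in every dimension). [folklore] -/
theorem latticeApprox_zero (δ : ℝ) : latticeApprox δ (0 : EuclideanSpace ℝ (Fin d)) = 0 := by
  funext i; simp [latticeApprox_apply]

/-- The configuration `(0, t𝟙)` of `ℝ^d`, `d ≥ 1`, `t ≠ 0`, is non-coincident. [folklore] -/
theorem zero_diag_mem_nonCoincident [NeZero d] {t : ℝ} (ht : t ≠ 0) :
    (![0, WithLp.toLp 2 fun _ : Fin d => t] : Fin 2 → EuclideanSpace ℝ (Fin d)) ∈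
      NonCoincident d 2 := by
  rw [mem_nonCoincident]
  intro i j hij
  fin_cases i <;> fin_cases j
  · rfl
  · exfalso
    have h := congrArg (fun v : EuclideanSpace ℝ (Fin d) => v 0) hij
    simp at h
    exact ht h.symm
  · exfalso
    have h := congrArg (fun v : EuclideanSpace ℝ (Fin d) => v 0) hij
    simp at h
    exact ht h
  · rfl

/-- The rescaled critical two-point correlator at `(0, t𝟙)` along the dyadic meshes is
`ρ(2^{-k})² ⟨σ₀ σ_{t2^k 𝟙}⟩⁺_{β_c}` (`criticalCorr_two`). [folklore] -/
theorem rescaledCorrelator_dyadic_diag (ρ : ℝ → ℝ) (k t : ℕ) :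
    rescaledCorrelator (criticalCorr d) ρ 2 (((2 : ℝ) ^ k)⁻¹)
        ![0, WithLp.toLp 2 fun _ : Fin d => (t : ℝ)] =
      ρ (((2 : ℝ) ^ k)⁻¹) ^ 2 * criticalTwoPoint d (fun _ => ((t * 2 ^ k : ℕ) : ℤ)) := by
  rw [rescaledCorrelator_apply, ← criticalCorr_two]
  congr 1
  congr 1
  funext i
  fin_cases i
  · simp [latticeApprox_zero]
  · simpa using latticeApprox_dyadic_diag k t

/-! ### Steps 1–3: the ratio argument along the dyadic meshes -/

section Limit

variable [NeZero d] {ρ : ℝ → ℝ} {Δ : ℝ} {S : CorrFamily d}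

/-- Step 1 — pointwise convergence at `(0, t𝟙)` along the dyadic meshes:
`ρ(2^{-k})² ⟨σ₀σ_{t2^k 𝟙}⟩⁺_{β_c} → S₂(0, t𝟙)` for `t ∈ ℕ`, `t ≠ 0`. [folklore] -/
theorem tendsto_rescaled_dyadic_diag (hlim : HasPointwiseScalingLimit (criticalCorr d) ρ S)
    {t : ℕ} (ht : t ≠ 0) :
    Tendsto (fun k : ℕ => ρ (((2 : ℝ) ^ k)⁻¹) ^ 2 *
        criticalTwoPoint d (fun _ => ((t * 2 ^ k : ℕ) : ℤ))) atTop
      (𝓝 (S 2 ![0, WithLp.toLp 2 fun _ : Fin d => (t : ℝ)])) := by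
  have h := (hlim 2).tendsto_at
    (zero_diag_mem_nonCoincident (d := d) (t := (t : ℝ)) (by exact_mod_cast ht))
  refine (h.comp tendsto_dyadic).congr fun k => ?_
  simp only [Function.comp_apply]
  exact rescaledCorrelator_dyadic_diag ρ k t

omit [NeZero d] in
/-- Step 2a — dilation covariance at `(0, 𝟙) ↦ (0, 2·𝟙)`: `S₂(0, 2·𝟙) = 2^{-2Δ} S₂(0, 𝟙)`
(Di Francesco–Mathieu–Sénéchal 1997, §4.3.1, eq. (4.49), `λ = 2`).
[cite: DiFrancescoMathieuSenechal1997, §4.3.1 eq. (4.49)] -/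
theorem two_point_diag_two (hsc : IsScaleCovariant Δ S) :
    S 2 ![0, WithLp.toLp 2 fun _ : Fin d => ((2 : ℕ) : ℝ)] =
      (2 : ℝ) ^ (-(2 : ℝ) * Δ) * S 2 ![0, WithLp.toLp 2 fun _ : Fin d => ((1 : ℕ) : ℝ)] := by
  have h := hsc 2 2 (by norm_num) ![0, WithLp.toLp 2 fun _ : Fin d => ((1 : ℕ) : ℝ)]
  have hcfg : (fun i => (2 : ℝ) • (![0, WithLp.toLp 2 fun _ : Fin d => ((1 : ℕ) : ℝ)] :
      Fin 2 → EuclideanSpace ℝ (Fin d)) i) =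
      ![0, WithLp.toLp 2 fun _ : Fin d => ((2 : ℕ) : ℝ)] := by
    funext i
    fin_cases i
    · simp
    · simp only [Nat.cast_ofNat, Fin.mk_one, Matrix.cons_val_one, Matrix.cons_val_fin_one,
        Nat.cast_one]
      ext j
      simp
  rw [hcfg] at h
  rw [h]
  norm_num

/-- Step 2b — **the ratio**: `⟨σ₀σ_{2^{k+1}𝟙}⟩ / ⟨σ₀σ_{2^k 𝟙}⟩ → 2^{-2Δ}`; the unknown
renormalisation `ρ(2^{-k})² > 0` cancels between `ρ(2^{-k})²⟨σ₀σ_{2·2^k𝟙}⟩ → 2^{-2Δ}S₂(0,𝟙)` and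
`ρ(2^{-k})²⟨σ₀σ_{2^k𝟙}⟩ → S₂(0,𝟙) > 0`. [folklore] -/
theorem tendsto_ratio_dyadic (hlim : HasPointwiseScalingLimit (criticalCorr d) ρ S)
    (hsc : IsScaleCovariant Δ S) (hnd : IsNondegenerateTwoPoint S)
    (hρ : ∀ δ ∈ Set.Ioc (0 : ℝ) 1, 0 < ρ δ) :
    Tendsto (fun k : ℕ => criticalTwoPoint d (fun _ => ((2 ^ (k + 1) : ℕ) : ℤ)) /
        criticalTwoPoint d (fun _ => ((2 ^ k : ℕ) : ℤ))) atTop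
      (𝓝 ((2 : ℝ) ^ (-(2 : ℝ) * Δ))) := by
  set s₁ := S 2 ![0, WithLp.toLp 2 fun _ : Fin d => ((1 : ℕ) : ℝ)] with hs₁
  have hs₁pos : 0 < s₁ := hnd _ (zero_diag_mem_nonCoincident (by norm_num))
  have hnum := tendsto_rescaled_dyadic_diag hlim (t := 2) two_ne_zero
  rw [two_point_diag_two hsc] at hnum
  have hden := tendsto_rescaled_dyadic_diag hlim (t := 1) one_ne_zero
  have hratio := hnum.div hden hs₁pos.ne'
  rw [mul_div_assoc, div_self hs₁pos.ne', mul_one] at hratio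
  refine hratio.congr fun k => ?_
  have hρk : ρ (((2 : ℝ) ^ k)⁻¹) ^ 2 ≠ 0 := pow_ne_zero _ (hρ _ (dyadic_mem_Ioc k)).ne'
  simp only [Pi.div_apply]
  rw [mul_div_mul_left _ _ hρk, pow_succ', one_mul]

/-- Step 3 — **`log ⟨σ₀σ_{2^k 𝟙}⟩ / k → -2Δ log 2`**: the correlator is eventually positive along
the dyadic diagonal sites (its renormalised version tends to `S₂(0,𝟙) > 0`), the logarithmic
increments tend to `log 2^{-2Δ} = -2Δ log 2` by Step 2b, and the Cesàro lemma applies. [folklore] -/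
theorem tendsto_log_dyadic_div (hlim : HasPointwiseScalingLimit (criticalCorr d) ρ S)
    (hsc : IsScaleCovariant Δ S) (hnd : IsNondegenerateTwoPoint S)
    (hρ : ∀ δ ∈ Set.Ioc (0 : ℝ) 1, 0 < ρ δ) :
    Tendsto (fun k : ℕ => Real.log (criticalTwoPoint d (fun _ => ((2 ^ k : ℕ) : ℤ))) / k) atTop
      (𝓝 (-(2 : ℝ) * Δ * Real.log 2)) := by
  -- eventually the correlator is positive along the dyadic diagonal sites
  have hs₁pos : 0 < S 2 ![0, WithLp.toLp 2 fun _ : Fin d => ((1 : ℕ) : ℝ)] :=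
    hnd _ (zero_diag_mem_nonCoincident (by norm_num))
  have hden := tendsto_rescaled_dyadic_diag hlim (t := 1) one_ne_zero
  have hpos : ∀ᶠ k : ℕ in atTop, 0 < criticalTwoPoint d (fun _ => ((2 ^ k : ℕ) : ℤ)) := by
    filter_upwards [hden.eventually_const_lt hs₁pos] with k hk
    rw [one_mul] at hk
    exact pos_of_mul_pos_right hk (sq_nonneg _)
  -- the logarithmic increments
  have hlog := (tendsto_ratio_dyadic hlim hsc hnd hρ).log (by positivity)
  rw [Real.log_rpow two_pos] at hlog
  have hdiff : Tendsto (fun k : ℕ =>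
      Real.log (criticalTwoPoint d (fun _ => ((2 ^ (k + 1) : ℕ) : ℤ))) -
        Real.log (criticalTwoPoint d (fun _ => ((2 ^ k : ℕ) : ℤ)))) atTop
      (𝓝 (-(2 : ℝ) * Δ * Real.log 2)) := by
    refine hlog.congr' ?_
    filter_upwards [hpos, (tendsto_add_atTop_nat 1).eventually hpos] with k hk hk1
    exact Real.log_div hk1.ne' hk.ne'
  exact tendsto_div_natCast_of_tendsto_sub hdiff

end Limit

/-! ### Step 4: comparison with the decay exponent -/

/-- The sup norm of the diagonal site `2^k 𝟙 ∈ ℤ^d` (`d ≥ 1`) is `2^k`. [folklore] -/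
theorem norm_dyadic_diag [NeZero d] (k : ℕ) :
    ‖(fun _ => ((2 ^ k : ℕ) : ℤ) : Site d)‖ = (2 : ℝ) ^ k := by
  haveI : Nonempty (Fin d) := ⟨0⟩
  rw [pi_norm_const, Int.norm_natCast]
  push_cast
  rfl

/-- The diagonal dyadic sites `k ↦ 2^k 𝟙` tend to infinity (`cofinite`) in `ℤ^d`, `d ≥ 1`
(the map is injective). [folklore] -/
theorem tendsto_dyadic_diag_cofinite [NeZero d] :
    Tendsto (fun k : ℕ => (fun _ => ((2 ^ k : ℕ) : ℤ) : Site d)) atTop cofinite := by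
  have hinj : Function.Injective (fun k : ℕ => (fun _ => ((2 ^ k : ℕ) : ℤ) : Site d)) := by
    intro j k hjk
    have h := congrFun hjk 0
    simp only [Nat.cast_inj] at h
    exact Nat.pow_right_injective le_rfl (by exact_mod_cast h)
  rw [← Nat.cofinite_eq_atTop]
  exact hinj.tendsto_cofinite

/-- **The Ising scaling relation in a fixed dimension `d ≥ 1`** (`IsingScalingRelationHolds d`):
a scale-covariant pointwise scaling limit of the critical correlators with dimension `Δ` and
non-degenerate two-point function, together with the anomalous dimension `η`
(`⟨σ₀σ_x⟩_{β_c} = ‖x‖^{-(d-2+η)+o(1)}`), forces `2Δ = d - 2 + η`. This is the relation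
`η = 2Δ + 2 - d` of Di Francesco–Mathieu–Sénéchal 1997, §4.3.1, eq. (4.56), obtained there by
comparing the dilation-covariant two-point function (4.49)/(4.55) with the definition of `η`
(§3.2.1, Table 3.1); here Steps 1–4 of the module docstring.
[cite: DiFrancescoMathieuSenechal1997, §4.3.1 eq. (4.56)] -/
theorem of_neZero [NeZero d] : IsingScalingRelationHolds d := by
  intro Δ η ρ S hρ hlim hsc hnd hη
  have hl2 : Real.log 2 ≠ 0 := (Real.log_pos one_lt_two).ne'
  -- Step 4a: the decay exponent along the diagonal dyadic sites
  have hη0 : Tendsto (fun x : Site d => Real.log (criticalTwoPoint d x) / Real.log ‖x‖) cofinite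
      (𝓝 (-((d : ℝ) - 2 + η))) := hη
  have hη1 := hη0.comp (tendsto_dyadic_diag_cofinite (d := d))
  have hη2 : Tendsto (fun k : ℕ =>
      Real.log (criticalTwoPoint d (fun _ => ((2 ^ k : ℕ) : ℤ))) / k) atTop
      (𝓝 (-((d : ℝ) - 2 + η) * Real.log 2)) := by
    refine (hη1.mul_const (Real.log 2)).congr' ?_
    filter_upwards [eventually_gt_atTop 0] with k hk
    have hk' : (k : ℝ) ≠ 0 := by exact_mod_cast hk.ne'
    simp only [Function.comp_apply]
    rw [norm_dyadic_diag k, Real.log_pow]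
    field_simp
  -- Step 3 and uniqueness of limits
  have h3 := tendsto_log_dyadic_div hlim hsc hnd hρ
  have heq := mul_right_cancel₀ hl2 (tendsto_nhds_unique h3 hη2)
  unfold IsingScalingRelation
  linarith

end IsingScalingRelationHolds

/-- **crit-ising.S22** — discharge of the named fact `isingScalingRelationHolds`: for every
`d ≥ 2` the Ising scaling relation `2Δ_σ = d - 2 + η` holds in the sense of
`IsingScalingRelationHolds d` (a scale-covariant, non-degenerate pointwise scaling limit of the
critical correlators with dimension `Δ`, together with the existence of `η`, forces
`2Δ = d - 2 + η`). Printed as `η = 2Δ + 2 - d`, Di Francesco–Mathieu–Sénéchal, *Conformal Field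
Theory* (1997), §4.3.1, pp. 104–106, eq. (4.56), from the dilation-covariant two-point function
(4.49)/(4.55) compared with the definition of `η` in §3.2.1, Table 3.1; proved here for every
`d ≥ 1` (`IsingScalingRelationHolds.of_neZero`) by the ratio/Cesàro argument of the module
docstring. [cite: DiFrancescoMathieuSenechal1997, §4.3.1 eq. (4.56)] -/
theorem isingScalingRelationHolds_holds : isingScalingRelationHolds := by
  intro d hd
  haveI : NeZero d := ⟨by omega⟩
  exact IsingScalingRelationHolds.of_neZero

end Literature.Probability.LatticeModels
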